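import Mathlib.RingTheory.Frobenius
import Mathlib.FieldTheory.Galois.IsGaloisGroup
import Mathlib.NumberTheory.NumberField.Basic
import Mathlib.RingTheory.DedekindDomain.AdicValuation
import Mathlib.FieldTheory.IsAlgClosed.AlgebraicClosure
import Mathlib.LinearAlgebra.FreeModule.IdealQuotient
import HarnessLib

/-!
# The Frobenius element of a sheet: `Frob_q ∘ ē = ē ∘ γ`

Topic `Literature/NumberTheory/NumberFields`, namespace `Literature.NumberTheory.NumberFields`.  THEOREMS ONLY (no `def`, no
instance, no named fact); Mathlib only.

## The statement (read at the page)

Let `A ⊆ B` be commutative rings and `G` a finite group of `A`-algebra automorphisms of `B` whose ring of invariants is (the image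
of) `A` (Mathlib `Algebra.IsInvariant A B G`; record: `A = 𝓞 F`, `B = 𝓞 Fᵢ`, `G = Gal(Fᵢ ∕ F)` for a finite Galois extension of
number fields).  A **sheet** is an `A`-algebra homomorphism `ē : B →ₐ[A] k` to a field `k` (record: `k = κ̄(w)`, an algebraic
closure of the residue field of a prime `w` of `F`; the sheets are then the pairs «prime `wᵢ ∣ w` of `Fᵢ`, embedding
`κ(wᵢ) ↪ κ̄(w)`»).  Put `q := #(A ∕ (A ∩ ker ē))` (record: `q = N w = #κ(w)`).  Then

> there is `γ ∈ G`, lying in the decomposition group of the prime `𝔓 = ker ē`, with `ē (γ b) = ē (b) ^ q` for all `b ∈ B` —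
> i.e. `Frob_q ∘ ē = ē ∘ γ`: **the `q`-power Frobenius of `k` moves the sheet `ē` to the sheet `ē ∘ γ`**,

and `γ` is exactly a Frobenius element at `𝔓` in the sense of Mathlib's `IsArithFrobAt A γ 𝔓` (`γ b ≡ b ^ q (mod 𝔓)`):
the two conditions are EQUIVALENT (`isArithFrobAt_ker_iff`), so existence is Mathlib's `IsArithFrobAt.exists_of_isInvariant`
(J. Neukirch, *Algebraic Number Theory* (1999), Ch. I §9, (9.4)–(9.6) and the Frobenius automorphism p. 58; D. Marcus, *Number
Fields*, Ch. 4 Thm. 32: the decomposition group surjects onto `Gal(κ(𝔓) ∕ κ(𝔭))`, whose generator is `x ↦ x^q`).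

## What is formalised

§1 (generic `A, B, G, k`): (private `under_ker_algHom`: `A ∩ ker ē = ker (A → k)`), **`isArithFrobAt_ker_iff`**, `exists_isArithFrobAt_ker`,
**`exists_smul_ker_eq_and_smul_apply_eq_pow`** (existence, with `γ • ker ē = ker ē`), `smul_apply_eq_pow_pow` (iterates:
`ē (γⁿ b) = ē (b) ^ qⁿ`), `smul_apply_eq_pow_comp` (the sheet `ē ∘ τ` has Frobenius element `τ⁻¹ γ τ`).
§2 (number fields `F ⊆ Fᵢ` Galois, `Gal(Fᵢ ∕ F) = Fᵢ ≃ₐ[F] Fᵢ` acting on `𝓞 Fᵢ` through Mathlib's `MulSemiringAction`):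
**`exists_isArithFrobAt_ker_ringOfIntegers`**, **`exists_gal_smul_apply_eq_pow`** (`q = #(𝓞 F ∕ ker (𝓞 F → k))`),
**`exists_gal_smul_apply_eq_pow_of_ker_eq`** (at a prime `w`: `q = #(𝓞 F ∕ w)`), **`exists_gal_smul_apply_eq_pow_residueField`**
(any field `k` over `κ(w)`; `q = #κ(w)`, the exponent of the tree's `frobeniusOver` on `κ(w)`-schemes; `= N w` by ★
`QuadraticForms.natCard_quotient_eq_absNorm` ∕ ★ `Motives.natCard_residueField`, not restated) and its instance
**`exists_gal_smul_apply_eq_pow_algebraicClosure`** (`k = κ̄(w) = AlgebraicClosure κ(w)`, the tree's `geomResidueField w`); private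
plumbing `ker_ne_bot_of_ker_algebraMap_ne_bot`, `finite_quotient_ker`, `natCard_quotient_eq_natCard_residueField`,
`ker_algebraMap_eq_of_isScalarTower_residueField`.  (The action on `𝓞 Fᵢ` is the restriction of the action on `Fᵢ`:
`((γ • b : 𝓞 Fᵢ) : Fᵢ) = γ b` holds by `rfl`.)

Cell `hodgecm-mathlib` FLOOR 0 P6 (MOD), sub-desk P6a: the arithmetic kernel of the named conjunct FROB-SHEET of the moduli heart
(`Fr₀ p = θ(γ, 1)_s (F̃ p)`: the sheet-corrected Frobenius of reading (β) exists BECAUSE `Frob_q ∘ ē = ē ∘ γ_w`); organ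
«SHEET-FROB» (F0P6c-plan «=» 2026-09-01); `--supports stmt-HodgeConjecture-24832`, count-neutral.  NOT here: uniqueness of `γ` at
primes unramified in `Fᵢ` (tree ★ `GaloisRepresentations.eq_of_isArithFrobAt_of_isUnramifiedIn`, heavier imports), the passage
from an embedding `e : Fᵢ →ₐ[F] Ω` into `Ω = \overline{F_w}` to its reduction `ē` (valuation-ring plumbing of the consumer), any
moduli word.

## Mathlib / tree search

Mathlib: `AlgHom.IsArithFrobAt`, `IsArithFrobAt`, `IsArithFrobAt.exists_of_isInvariant`, `IsArithFrobAt.mem_stabilizer`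
(`RingTheory/Frobenius`), `IsGaloisGroup` instances for `𝓞` (`FieldTheory/Galois/IsGaloisGroup`), `MulSemiringAction G (𝓞 K)`
(`NumberField/Basic`), `Ideal.finiteQuotientOfFreeOfNeBot`, `Ideal.bijective_algebraMap_quotient_residueField`.
Tree: ★ `GaloisRepresentations/FrobeniusDensityTheorem` (`exists_isArithFrobAt_ringOfIntegers` — existence at a PRIME `Q`, same
Mathlib route; not imported to keep this file Mathlib-only), ★ `LFunctions/ChebotarevDensityNumberField`,
★ `NumberFields/QuadraticExtensionFrobeniusProofs` (same incantation `IsGaloisGroup.isInvariant` + `exists_of_isInvariant`).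
-/

namespace Literature.NumberTheory.NumberFields

open NumberField IsDedekindDomain
open scoped Pointwise

/-! ### §1 Generic: a finite group of `A`-automorphisms of `B`, a sheet `ē : B →ₐ[A] k` -/

section Generic

variable {A B : Type*} [CommRing A] [CommRing B] [Algebra A B]
  {G : Type*} [Group G] [MulSemiringAction G B] [SMulCommClass G A B]
  {k : Type*} [Field k] [Algebra A k]

/-- For a sheet `ē : B →ₐ[A] k`, the prime of `A` under `ker ē` is the kernel of the structure map `A → k`
(`ē ∘ (A → B) = (A → k)`). [folklore] -/
private theorem under_ker_algHom (ē : B →ₐ[A] k) : (RingHom.ker ē).under A = RingHom.ker (algebraMap A k) := by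
  ext a
  simp only [Ideal.under_def, Ideal.mem_comap, RingHom.mem_ker, AlgHom.commutes]

/-- **Frobenius element at `ker ē` ⟺ Frobenius of the sheet.**  For `γ ∈ G` and a sheet `ē : B →ₐ[A] k`:
`γ` is an arithmetic Frobenius at the prime `ker ē` (Mathlib `IsArithFrobAt A γ (ker ē)`: `γ b - b ^ q ∈ ker ē` for all `b`)
iff `ē (γ b) = ē (b) ^ q` for all `b`, where `q = #(A ∕ ker (A → k))`.
[cite: NeukirchANT1999, Ch. I §9, (9.4)–(9.6) and p. 58] -/
theorem isArithFrobAt_ker_iff (ē : B →ₐ[A] k) (γ : G) :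
    IsArithFrobAt A γ (RingHom.ker ē) ↔
      ∀ b : B, ē (γ • b) = ē b ^ Nat.card (A ⧸ RingHom.ker (algebraMap A k)) := by
  rw [← under_ker_algHom ē]
  refine forall_congr' fun b => ?_
  rw [RingHom.mem_ker, MulSemiringAction.toAlgHom_apply, map_sub, map_pow, sub_eq_zero]

variable [Finite G] [Algebra.IsInvariant A B G]

/-- **A Frobenius element exists at the prime `ker ē` of a sheet** with finite residue ring (Mathlib
`IsArithFrobAt.exists_of_isInvariant`; the decomposition group of `𝔓` surjects onto `Gal(κ(𝔓) ∕ κ(𝔭))`).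
[cite: Marcus2018, Ch. 4, Thm. 32] -/
theorem exists_isArithFrobAt_ker (ē : B →ₐ[A] k) [Finite (B ⧸ RingHom.ker ē)] :
    ∃ γ : G, IsArithFrobAt A γ (RingHom.ker ē) :=
  haveI : (RingHom.ker ē).IsPrime := RingHom.ker_isPrime ē
  IsArithFrobAt.exists_of_isInvariant A G _

/-- **The Frobenius element of a sheet.**  For a sheet `ē : B →ₐ[A] k` with finite residue ring `B ∕ ker ē` there is `γ ∈ G`
in the decomposition group of `ker ē` (`γ • ker ē = ker ē`) with `ē (γ b) = ē (b) ^ q` for all `b ∈ B`, `q = #(A ∕ ker (A → k))`: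
the `q`-power Frobenius of `k` moves the sheet `ē` to the sheet `ē ∘ γ`. [cite: NeukirchANT1999, Ch. I §9, (9.4)–(9.6) and p. 58] -/
theorem exists_smul_ker_eq_and_smul_apply_eq_pow (ē : B →ₐ[A] k) [Finite (B ⧸ RingHom.ker ē)] :
    ∃ γ : G, γ • RingHom.ker ē = RingHom.ker ē ∧
      ∀ b : B, ē (γ • b) = ē b ^ Nat.card (A ⧸ RingHom.ker (algebraMap A k)) := by
  haveI : (RingHom.ker ē).IsPrime := RingHom.ker_isPrime ē
  obtain ⟨γ, hγ⟩ := exists_isArithFrobAt_ker (G := G) ē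
  exact ⟨γ, hγ.mem_stabilizer, (isArithFrobAt_ker_iff ē γ).mp hγ⟩

omit [SMulCommClass G A B] [Finite G] [Algebra.IsInvariant A B G] in
/-- Iterates: if `ē (γ b) = ē (b) ^ q` for all `b`, then `ē (γⁿ b) = ē (b) ^ (q ^ n)` for all `b` (the powers of the Frobenius
element act through the powers of `x ↦ x^q`). [cite: NeukirchANT1999, Ch. I §9, (9.4)–(9.6) and p. 58] -/
theorem smul_apply_eq_pow_pow {ē : B →ₐ[A] k} {γ : G} {q : ℕ} (h : ∀ b : B, ē (γ • b) = ē b ^ q) (n : ℕ) (b : B) :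
    ē (γ ^ n • b) = ē b ^ q ^ n := by
  induction n generalizing b with
  | zero => simp
  | succ n ih => rw [pow_succ', mul_smul, h, ih, ← pow_mul, ← pow_succ]

omit [SMulCommClass G A B] [Finite G] [Algebra.IsInvariant A B G] in
/-- Change of sheet: if `γ` is the Frobenius element of the sheet `ē`, then `τ⁻¹ γ τ` is the Frobenius element of the sheet
`ē ∘ τ` (`b ↦ ē (τ b)`), for every `τ ∈ G` (Mathlib `IsArithFrobAt.conj` read through `isArithFrobAt_ker_iff`).
[cite: Marcus2018, Ch. 4, remark after Thm. 32] -/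
theorem smul_apply_eq_pow_comp {ē : B →ₐ[A] k} {γ : G} {q : ℕ} (h : ∀ b : B, ē (γ • b) = ē b ^ q) (τ : G) (b : B) :
    ē (τ • ((τ⁻¹ * γ * τ) • b)) = ē (τ • b) ^ q := by
  rw [mul_smul, mul_smul, smul_inv_smul, h]

end Generic

/-! ### §2 Number fields: `Gal(Fᵢ ∕ F)` acting on `𝓞 Fᵢ`, sheets `ē : 𝓞 Fᵢ →ₐ[𝓞 F] k` -/

section NumberField

variable {F Fi : Type*} [Field F] [NumberField F] [Field Fi] [NumberField Fi] [Algebra F Fi]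
  {k : Type*} [Field k] [Algebra (𝓞 F) k]

omit [NumberField F] [NumberField Fi] in
/-- A sheet `ē : 𝓞 Fᵢ →ₐ[𝓞 F] k` into a field in which `𝓞 F` is NOT embedded (`ker (𝓞 F → k) ≠ 0`, i.e. `k` has positive
characteristic on the image of `𝓞 F`) has nonzero kernel. [folklore] -/
private theorem ker_ne_bot_of_ker_algebraMap_ne_bot (ē : 𝓞 Fi →ₐ[𝓞 F] k) (hk : RingHom.ker (algebraMap (𝓞 F) k) ≠ ⊥) :
    RingHom.ker ē ≠ ⊥ := by
  intro h
  apply hk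
  rw [← under_ker_algHom ē, h, Ideal.under_def]
  exact Ideal.comap_bot_of_injective _ (FaithfulSMul.algebraMap_injective (𝓞 F) (𝓞 Fi))

omit [NumberField F] in
/-- The residue ring `𝓞 Fᵢ ∕ ker ē` of a sheet into a field of positive characteristic (on `𝓞 F`) is finite. [folklore] -/
private theorem finite_quotient_ker (ē : 𝓞 Fi →ₐ[𝓞 F] k) (hk : RingHom.ker (algebraMap (𝓞 F) k) ≠ ⊥) :
    Finite (𝓞 Fi ⧸ RingHom.ker ē) :=
  Ideal.finiteQuotientOfFreeOfNeBot _ (ker_ne_bot_of_ker_algebraMap_ne_bot ē hk)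

variable [IsGalois F Fi]

/-- **A Frobenius element exists at the prime `ker ē` of every sheet `ē : 𝓞 Fᵢ →ₐ[𝓞 F] k`** (`Fᵢ ∕ F` Galois, `k` a field of
positive characteristic on `𝓞 F`): `∃ γ ∈ Gal(Fᵢ ∕ F)`, `IsArithFrobAt (𝓞 F) γ (ker ē)`.  (Mathlib `IsArithFrobAt.exists_of_isInvariant`
with `IsGaloisGroup (Fᵢ ≃ₐ[F] Fᵢ) (𝓞 F) (𝓞 Fᵢ)`.) [cite: Marcus2018, Ch. 4, Thm. 32] -/
theorem exists_isArithFrobAt_ker_ringOfIntegers (ē : 𝓞 Fi →ₐ[𝓞 F] k) (hk : RingHom.ker (algebraMap (𝓞 F) k) ≠ ⊥) :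
    ∃ γ : Fi ≃ₐ[F] Fi, IsArithFrobAt (𝓞 F) γ (RingHom.ker ē) := by
  haveI := finite_quotient_ker ē hk
  exact exists_isArithFrobAt_ker ē

/-- **The Frobenius element of a sheet of `𝓞 Fᵢ`.**  For `Fᵢ ∕ F` Galois and a sheet `ē : 𝓞 Fᵢ →ₐ[𝓞 F] k` into a field of
positive characteristic on `𝓞 F`: there is `γ ∈ Gal(Fᵢ ∕ F)` in the decomposition group of `ker ē` with
`ē (γ b) = ē (b) ^ q` for all `b ∈ 𝓞 Fᵢ`, `q = #(𝓞 F ∕ ker (𝓞 F → k))`. [cite: NeukirchANT1999, Ch. I §9, (9.4)–(9.6) and p. 58] -/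
theorem exists_gal_smul_apply_eq_pow (ē : 𝓞 Fi →ₐ[𝓞 F] k) (hk : RingHom.ker (algebraMap (𝓞 F) k) ≠ ⊥) :
    ∃ γ : Fi ≃ₐ[F] Fi, γ • RingHom.ker ē = RingHom.ker ē ∧
      ∀ b : 𝓞 Fi, ē (γ • b) = ē b ^ Nat.card (𝓞 F ⧸ RingHom.ker (algebraMap (𝓞 F) k)) := by
  haveI := finite_quotient_ker ē hk
  exact exists_smul_ker_eq_and_smul_apply_eq_pow ē

/-- **The Frobenius element of a sheet above a prime `w` of `F`.**  If the structure map `𝓞 F → k` has kernel `w`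
(e.g. `k ⊇ κ(w)`), then for every sheet `ē : 𝓞 Fᵢ →ₐ[𝓞 F] k` there is `γ ∈ Gal(Fᵢ ∕ F)` in the decomposition group of `ker ē`
with `ē (γ b) = ē (b) ^ #(𝓞 F ∕ w)` for all `b`: the `N w`-power Frobenius moves the sheet `ē` to `ē ∘ γ`.
[cite: NeukirchANT1999, Ch. I §9, (9.4)–(9.6) and p. 58] -/
theorem exists_gal_smul_apply_eq_pow_of_ker_eq (w : HeightOneSpectrum (𝓞 F)) (hk : RingHom.ker (algebraMap (𝓞 F) k) = w.asIdeal)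
    (ē : 𝓞 Fi →ₐ[𝓞 F] k) :
    ∃ γ : Fi ≃ₐ[F] Fi, γ • RingHom.ker ē = RingHom.ker ē ∧
      ∀ b : 𝓞 Fi, ē (γ • b) = ē b ^ Nat.card (𝓞 F ⧸ w.asIdeal) := by
  rw [← hk]
  exact exists_gal_smul_apply_eq_pow ē (hk ▸ w.ne_bot)

omit [IsGalois F Fi] in
/-- Exponent bookkeeping: `#(𝓞 F ∕ w) = #κ(w)` — the exponent of the `κ(w)`-linear Frobenius `F_{X ∕ κ(w)}` (the tree's
`frobeniusOver` raises sections to the power `Nat.card κ(w)`); `= N w` by ★ `QuadraticForms.natCard_quotient_eq_absNorm` ∕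
★ `Motives.natCard_residueField` (not restated). [folklore] -/
private theorem natCard_quotient_eq_natCard_residueField (w : HeightOneSpectrum (𝓞 F)) :
    Nat.card (𝓞 F ⧸ w.asIdeal) = Nat.card w.asIdeal.ResidueField :=
  haveI := w.isMaximal
  Nat.card_eq_of_bijective _ (Ideal.bijective_algebraMap_quotient_residueField w.asIdeal)

omit [NumberField F] [IsGalois F Fi] in
/-- If `k` is a field over the residue field `κ(w)` (compatibly with `𝓞 F`), the structure map `𝓞 F → k` has kernel `w`.
Applies to `k = κ̄(w) = AlgebraicClosure κ(w)` (the tree's `geomResidueField w`). [folklore] -/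
private theorem ker_algebraMap_eq_of_isScalarTower_residueField (w : HeightOneSpectrum (𝓞 F))
    [Algebra w.asIdeal.ResidueField k] [IsScalarTower (𝓞 F) w.asIdeal.ResidueField k] :
    RingHom.ker (algebraMap (𝓞 F) k) = w.asIdeal := by
  rw [IsScalarTower.algebraMap_eq (𝓞 F) w.asIdeal.ResidueField k, ← RingHom.comap_ker,
    (RingHom.injective_iff_ker_eq_bot _).mp (algebraMap w.asIdeal.ResidueField k).injective, ← RingHom.ker_eq_comap_bot,
    Ideal.ker_algebraMap_residueField]

/-- **The Frobenius element of a sheet into a field over `κ(w)`** (e.g. `κ̄(w) = AlgebraicClosure κ(w)`, the tree's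
`geomResidueField w`): for `Fᵢ ∕ F` Galois and every sheet `ē : 𝓞 Fᵢ →ₐ[𝓞 F] k` there is `γ ∈ Gal(Fᵢ ∕ F)` in the decomposition
group of `ker ē` with `ē (γ b) = ē (b) ^ #κ(w)` for all `b ∈ 𝓞 Fᵢ` — `Frob_{#κ(w)} ∘ ē = ē ∘ γ`.
[cite: NeukirchANT1999, Ch. I §9, (9.4)–(9.6) and p. 58] -/
theorem exists_gal_smul_apply_eq_pow_residueField (w : HeightOneSpectrum (𝓞 F))
    [Algebra w.asIdeal.ResidueField k] [IsScalarTower (𝓞 F) w.asIdeal.ResidueField k] (ē : 𝓞 Fi →ₐ[𝓞 F] k) :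
    ∃ γ : Fi ≃ₐ[F] Fi, γ • RingHom.ker ē = RingHom.ker ē ∧
      ∀ b : 𝓞 Fi, ē (γ • b) = ē b ^ Nat.card w.asIdeal.ResidueField := by
  rw [← natCard_quotient_eq_natCard_residueField]
  exact exists_gal_smul_apply_eq_pow_of_ker_eq w (ker_algebraMap_eq_of_isScalarTower_residueField w) ē

/-- The `κ̄(w)`-instance of the previous theorem, `κ̄(w) := AlgebraicClosure κ(w)` with its Mathlib `𝓞 F`-algebra structure
(the tree's `geomResidueField w`): every sheet `ē : 𝓞 Fᵢ →ₐ[𝓞 F] κ̄(w)` has a Frobenius element `γ ∈ Gal(Fᵢ ∕ F)`,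
`ē (γ b) = ē (b) ^ #κ(w)`. [cite: NeukirchANT1999, Ch. I §9, (9.4)–(9.6) and p. 58] -/
theorem exists_gal_smul_apply_eq_pow_algebraicClosure (w : HeightOneSpectrum (𝓞 F))
    (ē : 𝓞 Fi →ₐ[𝓞 F] AlgebraicClosure w.asIdeal.ResidueField) :
    ∃ γ : Fi ≃ₐ[F] Fi, γ • RingHom.ker ē = RingHom.ker ē ∧
      ∀ b : 𝓞 Fi, ē (γ • b) = ē b ^ Nat.card w.asIdeal.ResidueField :=
  exists_gal_smul_apply_eq_pow_residueField w ē

end NumberField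

end Literature.NumberTheory.NumberFields
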